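import Literature.AlgebraicGeometry.Smoothening.NeronPropertyCodimOne
import Literature.AlgebraicGeometry.Smoothening.SmoothSpecialFibre
import Literature.AlgebraicGeometry.Morphisms.SpecialFibreGenericPoint
import Literature.AlgebraicGeometry.Motives.ProductAffineChart
import Mathlib.AlgebraicGeometry.Morphisms.Smooth
import Mathlib.RingTheory.Flat.TorsionFree
import Mathlib.RingTheory.Ideal.Quotient.Nilpotent
import HarnessLib

/-!
# An affine chart of a smooth `R`-scheme against the two fibres of `Spec R` (`R` a dvr):
# the generic fibre is the basic open of `ϖ`, and `ϖ` is prime on the chart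

Topic `Literature/AlgebraicGeometry/Smoothening`, namespace `Literature.AlgebraicGeometry.Smoothening`
(next to `NeronPropertyCodimOne`, whose `preimage_range_specGenericPoint_eq` is the global form of
the first statement, and `SmoothSpecialFibre`, whose `isReduced_quotient_span_of_smooth` is the ring
form of «the special fibre of a smooth `R`-scheme is reduced»).

Let `R` be a discrete valuation ring with uniformizer `ϖ` and fraction field `K`, `𝒳 → Spec R` an
`R`-scheme and `V ⊆ 𝒳` an open with ring of sections `B = Γ(𝒳, V)`, an `R`-algebra through
`R = Γ(Spec R) → Γ(𝒳, ⊤) → Γ(𝒳, V)`; write `ϖ|_V` for the image of `ϖ`.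

* `inter_preimage_range_specGenericPoint_eq_basicOpen` — **`V ∩ 𝒳_K = 𝒳_{ϖ|_V}`**: the part of `V`
  over the generic point is the basic open of `ϖ|_V` (Bosch–Lütkebohmert–Raynaud §2.3: the generic
  fibre of `Spec B` is `Spec B[1/ϖ]`);
* `zeroLocus_eq_preimage_specialFibre` — for `V` affine, under the chart `Spec B → 𝒳` the zero locus
  of `ϖ|_V` is the preimage of the special fibre;
* `prime_algebraMap_sections_of_mem_specialFibre` — **`ϖ|_V` is a PRIME element of `B`** when
  `𝒳 → Spec R` is smooth with geometrically irreducible fibres and the affine `V` meets the special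
  fibre: `B/ϖB` is the ring of the open `V_k` of the smooth (reduced) irreducible special fibre `𝒳_k`,
  a domain (EGA IV₂ Prop. (2.3.4)/(4.5.?) style bookkeeping; BLR §2.3 «`R → 𝒪_{Z,η}` has ramification
  index 1», here on the whole chart); with `isDomain_quotient_span_algebraMap_sections`.

Cell `hodgecm-mathlib`, road W of `r₀`, (W0) sub-leaves GB and PU of B-p18's W0-CORE-SPEC (`stub_GB`,
`stub_PU` of `W0Core`). Theorems only; no definitions, no named facts.

## References
* S. Bosch, W. Lütkebohmert, M. Raynaud, *Néron Models*, Springer 1990, §2.3 (smoothness over a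
  discrete valuation ring: generic and special fibre of a smooth `R`-scheme). [BLRNeronModels1990]
  (Not held; section number only.)
* A. Grothendieck, J. Dieudonné, *EGA* IV₂, Publ. Math. IHÉS 24 (1965), Prop. (2.3.4) (fibres of an
  open morphism), and IV₄ (17.5.1) (smooth ⇒ reduced fibres). [GrothendieckDieudonne1965]
-/

noncomputable section

universe u

namespace Literature.AlgebraicGeometry.Smoothening

open CategoryTheory Limits _root_.AlgebraicGeometry TopologicalSpace
open Literature.AlgebraicGeometry.Morphisms Literature.AlgebraicGeometry.Motives
open Literature.NumberTheory.EllipticCurves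

variable {R : Type u} [CommRing R] [IsDomain R] [IsDiscreteValuationRing R]
  (K : Type u) [Field K] [Algebra R K] [IsFractionRing R K] (𝒳 : Over (Spec (.of R)))

/-! ### GB — the generic fibre of a chart is the basic open of `ϖ` -/

omit [IsDomain R] [IsDiscreteValuationRing R] in
/-- The image of `ϖ` in `Γ(𝒳, V)` is the restriction to `V` of its image `globalHom 𝒳 ϖ` in
`Γ(𝒳, ⊤)`. [folklore] -/
private theorem appLE_top_apply_eq_map_globalHom (ϖ : R) (V : 𝒳.left.Opens) :
    ((Scheme.ΓSpecIso (.of R)).inv ≫ 𝒳.hom.appLE ⊤ V le_top).hom ϖ =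
      𝒳.left.presheaf.map (homOfLE (le_top : V ≤ ⊤)).op (globalHom 𝒳 ϖ) := by
  rw [Scheme.Hom.appLE, globalHom]
  rfl

/-- **GB — `V ∩ 𝒳_K = 𝒳_{ϖ|_V}`.** For an open `V` of an `R`-scheme `𝒳` over a discrete valuation ring
with uniformizer `ϖ`, the points of `V` lying over the generic point `Spec K → Spec R` form the basic
open of `ϖ|_V ∈ Γ(𝒳, V)` (BLR §2.3: the generic fibre of a chart `Spec B` is `Spec B_ϖ`).
[cite: BLRNeronModels1990, §2.3] -/
theorem inter_preimage_range_specGenericPoint_eq_basicOpen {ϖ : R} (hϖ : Irreducible ϖ)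
    (V : 𝒳.left.Opens) :
    (V : Set 𝒳.left) ∩ 𝒳.hom.base ⁻¹' Set.range (specGenericPoint R K).base =
      (𝒳.left.basicOpen (((Scheme.ΓSpecIso (.of R)).inv ≫ 𝒳.hom.appLE ⊤ V le_top).hom ϖ) :
        Set 𝒳.left) := by
  rw [preimage_range_specGenericPoint_eq (K := K) (𝒳 := 𝒳) hϖ, appLE_top_apply_eq_map_globalHom,
    Scheme.basicOpen_res, Opens.coe_inf]

/-! ### PU — `ϖ` is prime on a chart meeting the special fibre -/

/-- For an AFFINE open `V` of an `R`-scheme `𝒳`, under the chart `Spec Γ(𝒳, V) → 𝒳` the zero locus of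
`ϖ|_V` is the preimage of the special fibre `𝒳_k = 𝒳.hom⁻¹ {𝔪_R}` (a prime of `R` containing the
uniformizer is the maximal ideal). [cite: BLRNeronModels1990, §2.3] -/
theorem zeroLocus_eq_preimage_specialFibre {ϖ : R} (hϖ : Irreducible ϖ) {V : 𝒳.left.Opens}
    (hV : IsAffineOpen V) :
    PrimeSpectrum.zeroLocus {((Scheme.ΓSpecIso (.of R)).inv ≫ 𝒳.hom.appLE ⊤ V le_top).hom ϖ} =
      hV.fromSpec.base ⁻¹' (𝒳.hom.base ⁻¹' {IsLocalRing.closedPoint R}) := by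
  letI alg : Algebra R Γ(𝒳.left, V) :=
    ((Scheme.ΓSpecIso (.of R)).inv ≫ 𝒳.hom.appLE ⊤ V le_top).hom.toAlgebra
  have hfac : hV.fromSpec ≫ 𝒳.hom = Spec.map (CommRingCat.ofHom (algebraMap R Γ(𝒳.left, V))) :=
    fromSpec_comp_hom_eq_SpecMap_algebraMap (E := 𝒳) hV rfl
  have hbase : ∀ t : Spec (.of Γ(𝒳.left, V)),
      𝒳.hom.base (hV.fromSpec.base t) = PrimeSpectrum.comap (algebraMap R Γ(𝒳.left, V)) t := fun t => by
    change (hV.fromSpec ≫ 𝒳.hom).base t = _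
    rw [hfac]
    rfl
  ext t
  simp only [PrimeSpectrum.mem_zeroLocus, Set.singleton_subset_iff, SetLike.mem_coe]
  change algebraMap R Γ(𝒳.left, V) ϖ ∈ t.asIdeal ↔
    𝒳.hom.base (hV.fromSpec.base t) = IsLocalRing.closedPoint R
  rw [hbase t]
  constructor
  · intro ht
    apply PrimeSpectrum.ext
    change Ideal.comap (algebraMap R Γ(𝒳.left, V)) t.asIdeal = IsLocalRing.maximalIdeal R
    refine le_antisymm (IsLocalRing.le_maximalIdeal Ideal.IsPrime.ne_top') ?_
    rw [hϖ.maximalIdeal_eq, Ideal.span_le, Set.singleton_subset_iff]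
    exact ht
  · intro ht
    have h2 : Ideal.comap (algebraMap R Γ(𝒳.left, V)) t.asIdeal = IsLocalRing.maximalIdeal R := by
      change (PrimeSpectrum.comap (algebraMap R Γ(𝒳.left, V)) t).asIdeal = _
      rw [ht]
      rfl
    have : ϖ ∈ Ideal.comap (algebraMap R Γ(𝒳.left, V)) t.asIdeal := by
      rw [h2, hϖ.maximalIdeal_eq]
      exact Ideal.mem_span_singleton_self ϖ
    exact this

omit [IsDomain R] [IsDiscreteValuationRing R] in
/-- The ring of sections of an affine open of a smooth `R`-scheme is a smooth `R`-algebra (for the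
chart algebra structure `R → Γ(𝒳, ⊤) → Γ(𝒳, V)`; Mathlib `HasRingHomProperty.appLE`). [folklore] -/
private theorem smooth_appLE_top [Smooth 𝒳.hom] {V : 𝒳.left.Opens} (hV : IsAffineOpen V) :
    ((Scheme.ΓSpecIso (.of R)).inv ≫ 𝒳.hom.appLE ⊤ V le_top).hom.Smooth := by
  have h1 : (𝒳.hom.appLE ⊤ V le_top).hom.Smooth :=
    HasRingHomProperty.appLE (P := @Smooth) 𝒳.hom inferInstance ⟨⊤, isAffineOpen_top _⟩ ⟨V, hV⟩
      le_top
  rw [CommRingCat.hom_comp]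
  exact RingHom.Smooth.comp
    (RingHom.Smooth.of_bijective (Scheme.ΓSpecIso (.of R)).commRingCatIsoToRingEquiv.symm.bijective) h1

/-- **The special fibre of an affine chart of a smooth `R`-scheme with geometrically irreducible
fibres is integral**: for `V` affine meeting the special fibre, `Γ(𝒳, V) ⧸ (ϖ|_V)` is a domain — it is
reduced (smooth special fibre, ★ `isReduced_quotient_span_of_smooth`) and its spectrum, the preimage
of the irreducible special fibre under the open chart, is irreducible.
[cite: BLRNeronModels1990, §2.3] -/
theorem isDomain_quotient_span_algebraMap_sections {ϖ : R} (hϖ : Irreducible ϖ) [Smooth 𝒳.hom]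
    [GeometricallyIrreducible 𝒳.hom] {V : 𝒳.left.Opens} (hV : IsAffineOpen V)
    {x : 𝒳.left} (hxV : x ∈ V) (hx : 𝒳.hom.base x = IsLocalRing.closedPoint R) :
    IsDomain (Γ(𝒳.left, V) ⧸
      Ideal.span {((Scheme.ΓSpecIso (.of R)).inv ≫ 𝒳.hom.appLE ⊤ V le_top).hom ϖ}) := by
  letI alg : Algebra R Γ(𝒳.left, V) :=
    ((Scheme.ΓSpecIso (.of R)).inv ≫ 𝒳.hom.appLE ⊤ V le_top).hom.toAlgebra
  haveI : Algebra.Smooth R Γ(𝒳.left, V) := smooth_appLE_top 𝒳 hV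
  set b := ((Scheme.ΓSpecIso (.of R)).inv ≫ 𝒳.hom.appLE ⊤ V le_top).hom ϖ with hbdef
  have hb : b = algebraMap R Γ(𝒳.left, V) ϖ := rfl
  -- reduced
  haveI hred : IsReduced (Γ(𝒳.left, V) ⧸ Ideal.span {b}) := by
    rw [hb]
    exact isReduced_quotient_span_of_smooth hϖ _
  have hrad : (Ideal.span {b}).IsRadical := (Ideal.isRadical_iff_quotient_reduced _).mpr hred
  -- irreducible
  have hirr : IsIrreducible (PrimeSpectrum.zeroLocus ({b} : Set Γ(𝒳.left, V))) := by
    rw [hbdef, zeroLocus_eq_preimage_specialFibre 𝒳 hϖ hV]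
    refine ⟨?_, (isIrreducible_preimage_closedPoint 𝒳).isPreirreducible.preimage
      hV.fromSpec.isOpenEmbedding⟩
    have hxr : x ∈ Set.range hV.fromSpec := by
      rw [IsAffineOpen.range_fromSpec]
      exact hxV
    obtain ⟨t, ht⟩ := hxr
    refine ⟨t, ?_⟩
    change 𝒳.hom.base (hV.fromSpec.base t) = IsLocalRing.closedPoint R
    change hV.fromSpec.base t = x at ht
    rw [ht]
    exact hx
  have hprime : (Ideal.span ({b} : Set Γ(𝒳.left, V))).IsPrime := by
    rw [← PrimeSpectrum.isIrreducible_zeroLocus_iff_of_radical _ hrad, PrimeSpectrum.zeroLocus_span]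
    exact hirr
  exact (Ideal.Quotient.isDomain_iff_prime _).mpr hprime

/-- **PU — `ϖ` is a prime element of the ring of an affine chart meeting the special fibre** of a
smooth `R`-scheme with geometrically irreducible fibres (`R` a discrete valuation ring with
uniformizer `ϖ`): `Γ(𝒳, V) ⧸ (ϖ|_V)` is a domain and `ϖ|_V ≠ 0` (`Γ(𝒳, V)` is flat over `R`).
[cite: BLRNeronModels1990, §2.3] -/
theorem prime_algebraMap_sections_of_mem_specialFibre {ϖ : R} (hϖ : Irreducible ϖ) [Smooth 𝒳.hom]
    [GeometricallyIrreducible 𝒳.hom] {V : 𝒳.left.Opens} (hV : IsAffineOpen V)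
    {x : 𝒳.left} (hxV : x ∈ V) (hx : 𝒳.hom.base x = IsLocalRing.closedPoint R) :
    Prime (((Scheme.ΓSpecIso (.of R)).inv ≫ 𝒳.hom.appLE ⊤ V le_top).hom ϖ) := by
  letI alg : Algebra R Γ(𝒳.left, V) :=
    ((Scheme.ΓSpecIso (.of R)).inv ≫ 𝒳.hom.appLE ⊤ V le_top).hom.toAlgebra
  haveI : Algebra.Smooth R Γ(𝒳.left, V) := smooth_appLE_top 𝒳 hV
  have hdom := isDomain_quotient_span_algebraMap_sections 𝒳 hϖ hV hxV hx
  have hprime := (Ideal.Quotient.isDomain_iff_prime _).mp hdom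
  -- `ϖ|_V ≠ 0`: `Γ(𝒳, V)` is a non-trivial flat `R`-module and `ϖ ≠ 0` in the domain `R`
  haveI : Nontrivial Γ(𝒳.left, V) := by
    haveI : Nonempty (Spec (.of Γ(𝒳.left, V))) := by
      have hxr : x ∈ Set.range hV.fromSpec := by
        rw [IsAffineOpen.range_fromSpec]
        exact hxV
      obtain ⟨t, -⟩ := hxr
      exact ⟨t⟩
    exact PrimeSpectrum.nonempty_iff_nontrivial.mp ‹_›
  have hb0 : ((Scheme.ΓSpecIso (.of R)).inv ≫ 𝒳.hom.appLE ⊤ V le_top).hom ϖ ≠ 0 := by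
    change algebraMap R Γ(𝒳.left, V) ϖ ≠ 0
    rw [Algebra.algebraMap_eq_smul_one]
    intro h0
    have hreg : IsSMulRegular Γ(𝒳.left, V) ϖ :=
      Module.Flat.isSMulRegular_of_nonZeroDivisors (mem_nonZeroDivisors_of_ne_zero hϖ.ne_zero)
    exact one_ne_zero (hreg (h0.trans (smul_zero ϖ).symm))
  exact (Ideal.span_singleton_prime hb0).mp hprime

end Literature.AlgebraicGeometry.Smoothening

end
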